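import Literature.NumberTheory.QuadraticForms.HasseMinkowskiQuaternaryRat
import Literature.NumberTheory.QuadraticForms.HilbertSymbolLocalQuinary
import HarnessLib

/-!
# Lemmas for Meyer's theorem over `ℚ` (Serre IV §3.2 Thm. 8 (iv), Cor. 2)

Topic `NumberTheory/QuadraticForms`; namespace `Literature.NumberTheory.QuadraticForms`. Everything
here is proved. Ingredients of the step `n = 5` of Serre's proof of the Hasse–Minkowski theorem
(*A Course in Arithmetic*, Ch. IV §3.2 Thm. 8 (iv), PDF p. 41) assembled in `MeyerRat.lean`:

* `exists_ternary_eq_of_isSquare_of_hilbertSymbol_eq` — the remaining case of the Corollary to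
  Thm. 6 (ii): `⟨a, b, c⟩` represents `x ≡ -abc` when `(a, b)_v = (x, -c)_v`; with
  `exists_ternary_eq_of_not_isSquare` this is the full representation criterion for ternary forms
  over `ℚ_v`;
* `exists_ternary_eq_of_units` — "if `v ∉ S`, the coefficients of `g` are `v`-adic units … `g`
  represents `a` in `ℚ_v`": a ternary form with `v`-unit rational coefficients (`v ∤ 2`)
  represents every non-zero rational over `ℚ_v`;
* `exists_sign_binary_ternary` — the real place: for an indefinite `⟨a₀, …, a₄⟩`, a sign
  represented over `ℝ` both by `⟨a₀, a₁⟩` (at a rational point) and by `-⟨a₂, a₃, a₄⟩`;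
* `placesOver` — the finite set of places of `ℚ` over the prime factors of an integer.

## References

* J.-P. Serre, *A Course in Arithmetic*, GTM 7, Springer 1973, Ch. IV §3.2 Thm. 8 (iv) (PDF
  p. 41), §2.2 Cor. to Thm. 6. [Serre1973]
-/

noncomputable section

open IsDedekindDomain NumberField Rat.HeightOneSpectrum Finset

namespace Literature.NumberTheory.QuadraticForms

section Local

variable (K : Type) [Field K] [NumberField K] (v : HeightOneSpectrum (𝓞 K))

/-- **Ternary forms over `K_v`, the class `-abc`** (Serre IV §2.2 Cor. to Thm. 6 (ii), remaining
case): if `x ≡ -abc` modulo squares and `(a, b)_v = (x, -c)_v`, then `⟨a, b, c⟩` represents `x`: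
the value `t = a` of `⟨a, b⟩` is also a value of `⟨x, -c⟩`, since the characters `(·, -ab)_v` and
`(·, cx)_v` coincide. [cite: Serre1973, Ch. IV §2.2 Cor. to Thm. 6] -/
theorem exists_ternary_eq_of_isSquare_of_hilbertSymbol_eq {a b c x : v.adicCompletion K}
    (ha : a ≠ 0) (hb : b ≠ 0) (hc : c ≠ 0) (hx : x ≠ 0) (hsq : IsSquare (-(a * b * c * x)))
    (heq : hilbertSymbol (v.adicCompletion K) a b = hilbertSymbol (v.adicCompletion K) x (-c)) :
    ∃ y z w : v.adicCompletion K, a * y ^ 2 + b * z ^ 2 + c * w ^ 2 = x := by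
  haveI := neZero_two_adicCompletion K v
  obtain ⟨s, hs⟩ := hsq
  have hs0 : s ≠ 0 := by
    rintro rfl
    exact neg_ne_zero.2 (mul_ne_zero (mul_ne_zero (mul_ne_zero ha hb) hc) hx) (by simpa using hs)
  -- `⟨x, -c⟩` represents `a`
  have hab : a * b ≠ 0 := mul_ne_zero ha hb
  have key : -(x * -c) = -(a * b) * (s / (a * b)) ^ 2 := by
    rw [div_pow, mul_div_assoc']
    field_simp
    linear_combination -hs
  have hrep2 : ∃ p w : v.adicCompletion K, x * p ^ 2 + (-c) * w ^ 2 = a := by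
    rw [exists_binary_eq_iff_hilbertSymbol K v hx (neg_ne_zero.2 hc) ha, key,
      hilbertSymbol_mul_sq_right _ _ (div_ne_zero hs0 hab),
      hilbertSymbol_neg_mul_right ha b, heq]
  obtain ⟨p, w, hpw⟩ := hrep2
  by_cases hp : p = 0
  · subst hp
    have hw : w ≠ 0 := by
      rintro rfl
      apply ha
      linear_combination -hpw
    -- `a + c w² = 0`: `⟨a, b, c⟩` is isotropic (`(1, 0, w)`), hence universal
    exact exists_ternary_eq_of_zero ha hb hc (p₁ := 1) (p₂ := 0) (p₃ := w)
      (by linear_combination -hpw) (Or.inl one_ne_zero) x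
  · refine ⟨1 / p, 0, w / p, ?_⟩
    field_simp
    linear_combination -hpw

end Local

/-! ### Over `ℚ`: unit ternary forms at an odd place, the real place, places over primes -/

section Rat

/-- The Hilbert symbol in `ℚ_v` of two rationals whose integral representatives are prime to the
odd prime under `v` is `1` (units at a non-dyadic place). [folklore] -/
theorem hilbertSymbol_rat_eq_one_of_not_dvd (v : HeightOneSpectrum (𝓞 ℚ)) (hv : natGenerator v ≠ 2)
    {a b : ℚ} (ha : a ≠ 0) (hb : b ≠ 0) (hda : ¬ ((natGenerator v : ℕ) : ℤ) ∣ a.num * a.den)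
    (hdb : ¬ ((natGenerator v : ℕ) : ℤ) ∣ b.num * b.den) :
    hilbertSymbol (v.adicCompletion ℚ) (algebraMap ℚ _ a) (algebraMap ℚ _ b) = 1 := by
  rw [← ratSign_eq_hilbertSymbol v ha hb]
  refine ratSign_eq_one_of_not_dvd (prime_natGenerator v) fun h ↦ ?_
  have hp := Nat.prime_iff_prime_int.1 (prime_natGenerator v)
  rcases hp.dvd_or_dvd h with h | h
  · rcases hp.dvd_or_dvd h with h | h
    · exact hv ((Nat.prime_dvd_prime_iff_eq (prime_natGenerator v) Nat.prime_two).1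
        (by exact_mod_cast h))
    · exact hda h
  · exact hdb h

/-- **"If `v ∉ S`, the coefficients of `g` are `v`-adic units … hence `g` represents `a` in
`ℚ_v`"** (Serre IV §3.2 Thm. 8 (iv)): a ternary form `⟨b₂, b₃, b₄⟩` whose rational coefficients
have integral representatives prime to the odd prime under `v` represents every non-zero rational
over `ℚ_v` — by the two cases of the Corollary to Thm. 6 (ii), all the symbols of units being
`1`. [cite: Serre1973, Ch. IV §3.2 Thm. 8 (iv)] -/
theorem exists_ternary_eq_of_units (v : HeightOneSpectrum (𝓞 ℚ)) (hv : natGenerator v ≠ 2)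
    {b₂ b₃ b₄ x : ℚ} (h₂ : b₂ ≠ 0) (h₃ : b₃ ≠ 0) (h₄ : b₄ ≠ 0) (hx : x ≠ 0)
    (hd₂ : ¬ ((natGenerator v : ℕ) : ℤ) ∣ b₂.num * b₂.den)
    (hd₃ : ¬ ((natGenerator v : ℕ) : ℤ) ∣ b₃.num * b₃.den)
    (hd₄ : ¬ ((natGenerator v : ℕ) : ℤ) ∣ b₄.num * b₄.den) :
    ∃ p q r : v.adicCompletion ℚ, algebraMap ℚ _ b₂ * p ^ 2 + algebraMap ℚ _ b₃ * q ^ 2 +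
      algebraMap ℚ _ b₄ * r ^ 2 = algebraMap ℚ _ x := by
  haveI := neZero_two_adicCompletion_rat v
  set ι := algebraMap ℚ (v.adicCompletion ℚ) with hι
  have hι0 : ∀ {q : ℚ}, q ≠ 0 → ι q ≠ 0 := fun hq ↦ (map_ne_zero ι).2 hq
  by_cases hsq : IsSquare (-(ι b₂ * ι b₃ * ι b₄ * ι x))
  · refine exists_ternary_eq_of_isSquare_of_hilbertSymbol_eq ℚ v (hι0 h₂) (hι0 h₃) (hι0 h₄)
      (hι0 hx) hsq ?_
    -- both symbols are symbols of units
    have hD0 : -(b₂ * b₃ * b₄) ≠ 0 := neg_ne_zero.2 (mul_ne_zero (mul_ne_zero h₂ h₃) h₄)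
    obtain ⟨s, hs⟩ := hsq
    have hs0 : s ≠ 0 := by
      rintro rfl
      exact neg_ne_zero.2 (mul_ne_zero (mul_ne_zero (mul_ne_zero (hι0 h₂) (hι0 h₃)) (hι0 h₄))
        (hι0 hx)) (by simpa using hs)
    -- `x = -(b₂b₃b₄) · (s / (b₂b₃b₄))²`
    have hB0 : ι b₂ * ι b₃ * ι b₄ ≠ 0 := mul_ne_zero (mul_ne_zero (hι0 h₂) (hι0 h₃)) (hι0 h₄)
    have hxeq : ι x = ι (-(b₂ * b₃ * b₄)) * (s / (ι b₂ * ι b₃ * ι b₄)) ^ 2 := by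
      have h2' := hι0 h₂; have h3' := hι0 h₃; have h4'' := hι0 h₄
      rw [map_neg, map_mul ι, map_mul ι, div_pow, mul_div_assoc']
      field_simp
      linear_combination -hs
    rw [hilbertSymbol_rat_eq_one_of_not_dvd v hv h₂ h₃ hd₂ hd₃, hxeq,
      hilbertSymbol_mul_sq_left _ _ (div_ne_zero hs0 hB0), ← map_neg ι b₄]
    -- `(-(b₂b₃b₄), -b₄)_v = (-1, -b₄)(b₂, -b₄)(b₃, -b₄)(b₄, -b₄) = 1`
    have hn1 : ι (-(b₂ * b₃ * b₄)) = ι (-1) * ι b₂ * ι b₃ * ι b₄ := by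
      rw [← map_mul, ← map_mul, ← map_mul]; congr 1; ring
    have hd₄' : ¬ ((natGenerator v : ℕ) : ℤ) ∣ (-b₄).num * (-b₄).den := by
      rw [Rat.num_neg_eq_neg_num, Rat.den_neg_eq_den, neg_mul, dvd_neg]; exact hd₄
    have hdm1 : ¬ ((natGenerator v : ℕ) : ℤ) ∣ (-1 : ℚ).num * (-1 : ℚ).den := by
      have : (-1 : ℚ).num * ((-1 : ℚ).den : ℤ) = -1 := by norm_num
      rw [this, dvd_neg]
      intro h
      exact (prime_natGenerator v).ne_one (by exact_mod_cast Int.eq_one_of_dvd_one (by positivity) h)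
    have h4' : (-b₄) ≠ 0 := neg_ne_zero.2 h₄
    rw [hn1, hilbertSymbol_adicCompletion_mul_left ℚ v (mul_ne_zero (mul_ne_zero (hι0 (by norm_num))
        (hι0 h₂)) (hι0 h₃)) (hι0 h₄) (hι0 h4'),
      hilbertSymbol_adicCompletion_mul_left ℚ v (mul_ne_zero (hι0 (by norm_num)) (hι0 h₂)) (hι0 h₃)
        (hι0 h4'),
      hilbertSymbol_adicCompletion_mul_left ℚ v (hι0 (by norm_num)) (hι0 h₂) (hι0 h4'),
      hilbertSymbol_rat_eq_one_of_not_dvd v hv (by norm_num) h4' hdm1 hd₄',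
      hilbertSymbol_rat_eq_one_of_not_dvd v hv h₂ h4' hd₂ hd₄',
      hilbertSymbol_rat_eq_one_of_not_dvd v hv h₃ h4' hd₃ hd₄',
      hilbertSymbol_rat_eq_one_of_not_dvd v hv h₄ h4' hd₄ hd₄']
    norm_num
  · exact exists_ternary_eq_of_not_isSquare ℚ v (hι0 h₂) (hι0 h₃) (hι0 h₄) (hι0 hx) hsq

/-- **The real place in the step `n = 5`**: if `⟨a₀, …, a₄⟩` (`aᵢ ∈ ℚˣ`) is indefinite, there is
a sign `σ = ±1` such that `h = ⟨a₀, a₁⟩` takes a value of sign `σ` at a rational point and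
`g = -⟨a₂, a₃, a₄⟩` has a coefficient of sign `σ` (so that `g` represents the values of sign `σ`
over `ℝ`): the existence of "`x_∞` represented by both `h` and `g`" in Serre's proof.
[cite: Serre1973, Ch. IV §3.2 Thm. 8 (iv)] -/
theorem exists_sign_binary_ternary {a₀ a₁ a₂ a₃ a₄ : ℚ} (h₀ : a₀ ≠ 0) (h₁ : a₁ ≠ 0) (h₂ : a₂ ≠ 0)
    (h₃ : a₃ ≠ 0) (h₄ : a₄ ≠ 0) (hpos : ¬ (0 < a₀ ∧ 0 < a₁ ∧ 0 < a₂ ∧ 0 < a₃ ∧ 0 < a₄))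
    (hneg : ¬ (a₀ < 0 ∧ a₁ < 0 ∧ a₂ < 0 ∧ a₃ < 0 ∧ a₄ < 0)) :
    ∃ σ y₀ y₁ : ℚ, (σ = 1 ∨ σ = -1) ∧ 0 < σ * (a₀ * y₀ ^ 2 + a₁ * y₁ ^ 2) ∧
      (σ * a₂ < 0 ∨ σ * a₃ < 0 ∨ σ * a₄ < 0) := by
  by_cases hA : a₂ < 0 ∨ a₃ < 0 ∨ a₄ < 0
  · by_cases hB : 0 < a₀ ∨ 0 < a₁
    · -- `σ = 1`
      rcases hB with h | h
      · exact ⟨1, 1, 0, Or.inl rfl, by nlinarith, by simpa using hA⟩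
      · exact ⟨1, 0, 1, Or.inl rfl, by nlinarith, by simpa using hA⟩
    · -- `a₀, a₁ < 0`: `σ = -1`, and some `aᵢ > 0`, `i ≥ 2`
      push Not at hB
      have ha₀ : a₀ < 0 := lt_of_le_of_ne hB.1 h₀
      have ha₁ : a₁ < 0 := lt_of_le_of_ne hB.2 h₁
      have hC : 0 < a₂ ∨ 0 < a₃ ∨ 0 < a₄ := by
        by_contra hC
        push Not at hC
        exact hneg ⟨ha₀, ha₁, lt_of_le_of_ne hC.1 h₂, lt_of_le_of_ne hC.2.1 h₃,
          lt_of_le_of_ne hC.2.2 h₄⟩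
      refine ⟨-1, 1, 0, Or.inr rfl, by nlinarith, ?_⟩
      rcases hC with h | h | h
      · exact Or.inl (by nlinarith)
      · exact Or.inr (Or.inl (by nlinarith))
      · exact Or.inr (Or.inr (by nlinarith))
  · -- `a₂, a₃, a₄ > 0`: then `a₀` or `a₁` is negative, `σ = -1`
    push Not at hA
    have ha₂ : 0 < a₂ := lt_of_le_of_ne hA.1 (Ne.symm h₂)
    have ha₃ : 0 < a₃ := lt_of_le_of_ne hA.2.1 (Ne.symm h₃)
    have ha₄ : 0 < a₄ := lt_of_le_of_ne hA.2.2 (Ne.symm h₄)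
    have hB : a₀ < 0 ∨ a₁ < 0 := by
      by_contra hB
      push Not at hB
      exact hpos ⟨lt_of_le_of_ne hB.1 (Ne.symm h₀), lt_of_le_of_ne hB.2 (Ne.symm h₁), ha₂, ha₃, ha₄⟩
    rcases hB with h | h
    · exact ⟨-1, 1, 0, Or.inr rfl, by nlinarith, Or.inl (by nlinarith)⟩
    · exact ⟨-1, 0, 1, Or.inr rfl, by nlinarith, Or.inl (by nlinarith)⟩

/-- **Places of `ℚ` over a finite set of primes**: membership in the image of a finite set `T` of
primes under `primesEquiv.symm` is `natGenerator v ∈ T`. [folklore] -/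
theorem mem_image_primesEquiv_symm_iff [DecidableEq (HeightOneSpectrum (𝓞 ℚ))] (T : Finset ℕ)
    (hT : ∀ p ∈ T, p.Prime) (v : HeightOneSpectrum (𝓞 ℚ)) :
    v ∈ T.attach.image (fun p ↦ (primesEquiv (R := 𝓞 ℚ)).symm ⟨p.1, hT p.1 p.2⟩) ↔
      natGenerator v ∈ T := by
  constructor
  · rintro h
    obtain ⟨p, -, rfl⟩ := Finset.mem_image.1 h
    have : natGenerator ((primesEquiv (R := 𝓞 ℚ)).symm ⟨p.1, hT p.1 p.2⟩) = p.1 :=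
      congrArg Subtype.val ((primesEquiv (R := 𝓞 ℚ)).apply_symm_apply ⟨p.1, hT p.1 p.2⟩)
    rw [this]; exact p.2
  · intro h
    refine Finset.mem_image.2 ⟨⟨natGenerator v, h⟩, Finset.mem_attach _ _, ?_⟩
    apply (primesEquiv (R := 𝓞 ℚ)).injective
    rw [Equiv.apply_symm_apply]
    rfl

end Rat

end Literature.NumberTheory.QuadraticForms
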